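import Summits.Ventures.QEC.Census.CertCoverBatch
import Summits.Ventures.QEC.Census.BB.A1s_n168_k6_bf6588c5.CoreDefs
import HarnessLib

set_option Elab.async false
set_option maxRecDepth 200000

/-!
# `[[168,6,16]]` one-level cover certificate of `A1s_n168_k6_bf6588c5` — LEVEL-1→0 coset problems 236…236 (deep problems [10] excluded: `ProbDeep*.lean`) as COMPACT data
(`ProbData`: U, f, σ, y₀, allow; qec-type-10 `CertCoverBatch.mkCoset` rebuilds each `CosetProb` in the kernel) + their verdict
`probsOK cov covR hx hx1 D1 lxd 14` (one `decide +kernel`; 1 problems, depths f=0:1 f=1:0 f=2:0 f=3:0, est. 3.5 s).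
qec-search-1 g5 (pattern of search-9 g5 `Probs*`); data from JSON `level10.problems` (sha256 f70cd46222d7bc9c…). Data + decided check; KERNEL.
-/

namespace Summit.Ventures.QEC.Census.A1s_n168_k6_bf6588c5

open Matrix Summit.Ventures.QEC.Census Literature.InformationTheory.QuantumCodes

/-- Problems 236…236 (1): `⟨U, f, σ, y₀, allow⟩`. -/
def probs04 : List ProbData := [
    ⟨114572882887466901577728, 0, 826916487683, 76756902161077957738564, []⟩]

set_option maxHeartbeats 400000000 in
/-- Every problem of this chunk passes (`mkCoset` elimination + `cosetOKD` + fast `σ` + depth + `BU`-evenness + label checks). -/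
theorem probs04_ok : probsOK A1s_n168_k6_bf6588c5.cov covR hx hx1 D1 lxd 14 probs04 = true := by
  decide +kernel

/-- Pointwise form. -/
theorem probs04_all : ∀ x ∈ A1s_n168_k6_bf6588c5.probs04, probOK cov covR hx hx1 D1 lxd 14 x = true := by
  have h := probs04_ok
  rwa [probsOK, List.all_eq_true] at h

end Summit.Ventures.QEC.Census.A1s_n168_k6_bf6588c5
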